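import Mathlib
import HarnessLib
import Summits.Ventures.LatticeQCDFlow.Scoring.UStatisticVariance

/-!
# LatticeQCDFlow / Scoring — the EXACT variance of the pair-min acceptance statistic and its SHARP
# distribution-free envelope `Var U ≤ (2(1 − a²) + 4(n − 2)·a(1 − a)) / (n(n − 1))`, ATTAINED by the
# hit-or-miss flow at every `n` and every acceptance `a`

HONEST FRAMING: exact (Metropolis-corrected) sampling algorithms for lattice gauge theory;
figures of merit are autocorrelation/cost numbers at stated couplings and volumes; no
continuum-physics claim.

Venture `LatticeQCDFlow` (cell pub-lqcd), sub-topic `Scoring`; FANOUT row 3 (`s0-u1-a`, S0-B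
implementation A, GEN-8).  NEW WORK of the cell (two one-line weight inequalities inserted in
Hoeffding's exact law, row 3's `Scoring/UStatisticVariance`, imported, and a two-point witness),
not a published result; NO definition is introduced.  It closes the item "sharpness of the constant
`4`" listed as NOT CLAIMED in row 3's `Scoring/PairAcceptanceVariance` (GEN-7,
`Var U ≤ (4n − 6)(1 − a²)/(n(n−1)) < 4/n`): the constant `4` in front of `(1 − a²)/n` is NOT sharp;
the sharp law has the Bernoulli leading term `4a(1 − a)/n ≤ 1/n` and is a maximum.

## Setting (finite `X`; target `p ≥ 0` and model `q > 0` normalised; `w = p/q`, `E_q w = 1`;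
## `n ≥ 2` i.i.d. proposals, law `blockProd (fun _ ↦ q)`; `U = Σ_{i≠j} min(w_i, w_j)/(n(n−1))`,
## `E U = a = acc(p, q) = E_{q⊗q} min(w, w′)` by row 11's `accRate_eq_qq_min_weight`)

Write `h₁(x) = Σ_y q_y min(w_x, w_y)`, `m₁ = Σ_x q_x h₁(x)²`, `m₂ = Σ_xΣ_y q_x q_y min(w_x, w_y)²`.

* **`variance_pairMin_eq`** — `E[(U − a)²] = (2(m₂ − a²) + 4(n − 2)(m₁ − a²)) / (n(n − 1))`
  (Hoeffding's law for the kernel `min(w, w′)`; only `q > 0`, `Σ q = 1` used);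
* `condMean_sq_le_accRate` — `m₁ ≤ a` (because `0 ≤ h₁ ≤ Σ_y q_y w_y = 1`, so `h₁² ≤ h₁`);
  `qq_min_weight_sq_le_one` — `m₂ ≤ 1` (because `min(w, w′)² ≤ w·w′`, of `q⊗q`-mean `(E_q w)² = 1`);
* **`variance_pairMin_le_sharp`** — `E[(U − a)²] ≤ (2(1 − a²) + 4(n − 2)·a(1 − a)) / (n(n − 1))`
  for EVERY flow; **`variance_pairMin_le_sharp'`** — the clean forms
  `≤ 4a(1 − a)/n + 2(1 − a²)/(n(n − 1)) ≤ (n + 1)/(n(n − 1))` (hence `≤ 2/n` from `n = 3` on: the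
  acceptance error bar read off `n` fresh proposals is `≤ √((n+1)/(n−1))/√n` for every flow, e.g.
  `< 0.01106` at `n = 8 192`, and `≈ √(4a(1−a)/n)` once `a` is roughly known);
* **`chebyshev_pairMin_sharp`** — `P(|U − a| ≥ t) ≤ (4a(1−a)/n + 2(1−a²)/(n(n−1)))/t²`;
* **`hitOrMiss_moments`**, **`hitOrMiss_variance_pairMin`**, **`exists_variance_pairMin_eq_sharp`**
  — SHARPNESS: on two points, target `p = δ_hit = ![0, 1]` and model `q = ![1 − α, α]` hitting it
  with probability `α` (weights `0` and `1/α`: every proposal is either an exact target draw or has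
  target weight zero) give `acc = α`, `m₁ = α`, `m₂ = 1`, hence `Var U` EQUAL to the envelope at
  every `n ≥ 2`; so for every `n ≥ 2` and `a ∈ (0, 1)` the envelope is the MAXIMUM of `Var U` over
  finite normalised pairs with acceptance `a` (there `n(n−1)·a·U = K(K−1)`, `K ∼ Bin(n, a)` hits).

NOT CLAIMED: anything about the SELF-NORMALISED monitor `acc_est` beyond what row 3's
`Scoring/AcceptanceMonitorConcentration` derives from any variance bound on `U` (its first term
improves from `4/(nt²)` to `(n+1)/(n(n−1)t²)` by `chebyshev_pairMin_sharp` — not restated);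
exponential tails (weights unbounded; Chebyshev level only); uniqueness of the maximiser; any
acceptance, `m₁`, `m₂` or error bar of ours; nothing re-scored.
-/

namespace Summit.Ventures.LatticeQCDFlow.Scoring

open Finset
open Literature.Probability.MarkovChains
open Summit.Ventures.LatticeQCDFlow.Exactness
open Summit.Ventures.LatticeQCDFlow.Theory2

/-! ### The exact variance for the kernel `min(w, w′)` and the two weight inequalities -/

section PairMinSharp

variable {X : Type*} [Fintype X] {n : ℕ}

/-- **The exact variance of the pair-min statistic** (Hoeffding's law, kernel `min(w, w′)`): for a
positive normalised model `q`, any `p`, `w = p/q` and `n ≥ 2` i.i.d. proposals,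
`E[(U − a)²] = (2(m₂ − a²) + 4(n − 2)(m₁ − a²)) / (n(n − 1))` with `a = acc(p, q)`,
`m₂ = E_{q⊗q} min(w, w′)²`, `m₁ = E_q h₁²`. [folklore] -/
theorem variance_pairMin_eq {p q : X → ℝ} (hq : ∀ x, 0 < q x) (hq1 : ∑ x, q x = 1) (hn : 2 ≤ n) :
    ∑ φ : Fin n → X, blockProd (fun _ => q) φ
        * ((∑ z ∈ (univ : Finset (Fin n)).offDiag, min (weight p q (φ z.1)) (weight p q (φ z.2)))
            / (n * (n - 1)) - accRate p q) ^ 2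
      = (2 * ((∑ x, ∑ y, q x * q y * min (weight p q x) (weight p q y) ^ 2) - accRate p q ^ 2)
          + 4 * (n - 2) * ((∑ x, q x * (∑ y, q y * min (weight p q x) (weight p q y)) ^ 2)
            - accRate p q ^ 2)) / (n * (n - 1)) := by
  have h := variance_ustat₂_eq (n := n) q hq1
    (F := fun x y => min (weight p q x) (weight p q y)) (fun x y => min_comm _ _) hn
  rw [← accRate_eq_qq_min_weight hq] at h
  exact h

/-- **`m₁ ≤ acc`**: the conditional mean `h₁(x) = Σ_y q_y min(w_x, w_y)` lies in `[0, 1]`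
(`≤ Σ_y q_y w_y = 1`), so `Σ_x q_x h₁(x)² ≤ Σ_x q_x h₁(x) = acc(p, q)`. [folklore] -/
theorem condMean_sq_le_accRate {p q : X → ℝ} (hp : ∀ x, 0 ≤ p x) (hq : ∀ x, 0 < q x)
    (hp1 : ∑ x, p x = 1) :
    ∑ x, q x * (∑ y, q y * min (weight p q x) (weight p q y)) ^ 2 ≤ accRate p q := by
  have hw : ∀ z, 0 ≤ weight p q z := fun z => div_nonneg (hp z) (hq z).le
  rw [accRate_eq_qq_min_weight hq]
  refine sum_le_sum fun x _ => ?_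
  have h0 : 0 ≤ ∑ y, q y * min (weight p q x) (weight p q y) :=
    sum_nonneg fun y _ => mul_nonneg (hq y).le (le_min (hw x) (hw y))
  have h1 : ∑ y, q y * min (weight p q x) (weight p q y) ≤ 1 :=
    calc ∑ y, q y * min (weight p q x) (weight p q y) ≤ ∑ y, q y * weight p q y :=
          sum_le_sum fun y _ => mul_le_mul_of_nonneg_left (min_le_right _ _) (hq y).le
      _ = 1 := sum_mul_weight hq hp1
  have e : ∑ y, q x * q y * min (weight p q x) (weight p q y)
      = q x * ∑ y, q y * min (weight p q x) (weight p q y) := by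
    rw [mul_sum]
    exact sum_congr rfl fun y _ => by ring
  rw [e]
  refine mul_le_mul_of_nonneg_left ?_ (hq x).le
  calc (∑ y, q y * min (weight p q x) (weight p q y)) ^ 2
      = (∑ y, q y * min (weight p q x) (weight p q y))
          * ∑ y, q y * min (weight p q x) (weight p q y) := sq _
    _ ≤ 1 * ∑ y, q y * min (weight p q x) (weight p q y) := mul_le_mul_of_nonneg_right h1 h0
    _ = _ := one_mul _

/-- **`m₂ ≤ 1`**: `min(w, w′)² ≤ w·w′`, whose `q ⊗ q` mean is `(E_q w)² = 1`. [folklore] -/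
theorem qq_min_weight_sq_le_one {p q : X → ℝ} (hp : ∀ x, 0 ≤ p x) (hq : ∀ x, 0 < q x)
    (hp1 : ∑ x, p x = 1) :
    ∑ x, ∑ y, q x * q y * min (weight p q x) (weight p q y) ^ 2 ≤ 1 := by
  have hw : ∀ z, 0 ≤ weight p q z := fun z => div_nonneg (hp z) (hq z).le
  calc ∑ x, ∑ y, q x * q y * min (weight p q x) (weight p q y) ^ 2
      ≤ ∑ x, ∑ y, q x * q y * (weight p q x * weight p q y) := by
        refine sum_le_sum fun x _ => sum_le_sum fun y _ =>
          mul_le_mul_of_nonneg_left ?_ (mul_nonneg (hq x).le (hq y).le)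
        rw [sq]
        exact mul_le_mul (min_le_left _ _) (min_le_right _ _) (le_min (hw x) (hw y)) (hw x)
    _ = (∑ x, q x * weight p q x) * ∑ y, q y * weight p q y := by
        rw [sum_mul_sum]
        exact sum_congr rfl fun x _ => sum_congr rfl fun y _ => by ring
    _ = 1 := by rw [sum_mul_weight hq hp1, mul_one]

/-! ### The sharp envelope and its clean forms -/

/-- **The sharp distribution-free envelope.**  For a normalised target `p ≥ 0`, a positive
normalised model `q` and `n ≥ 2` i.i.d. proposals:
`E[(U − a)²] ≤ (2(1 − a²) + 4(n − 2)·a(1 − a)) / (n(n − 1))`, `a = acc(p, q)` — from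
`variance_pairMin_eq` with `m₂ ≤ 1` and `m₁ ≤ a`.  Attained: `exists_variance_pairMin_eq_sharp`.
[folklore] -/
theorem variance_pairMin_le_sharp {p q : X → ℝ} (hp : ∀ x, 0 ≤ p x) (hq : ∀ x, 0 < q x)
    (hp1 : ∑ x, p x = 1) (hq1 : ∑ x, q x = 1) (hn : 2 ≤ n) :
    ∑ φ : Fin n → X, blockProd (fun _ => q) φ
        * ((∑ z ∈ (univ : Finset (Fin n)).offDiag, min (weight p q (φ z.1)) (weight p q (φ z.2)))
            / (n * (n - 1)) - accRate p q) ^ 2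
      ≤ (2 * (1 - accRate p q ^ 2) + 4 * (n - 2) * (accRate p q * (1 - accRate p q)))
          / (n * (n - 1)) := by
  rw [variance_pairMin_eq hq hq1 hn]
  have hm2 := qq_min_weight_sq_le_one hp hq hp1
  have hm1 := condMean_sq_le_accRate hp hq hp1
  have h2 : (2 : ℝ) ≤ n := by exact_mod_cast hn
  have hNpos : (0 : ℝ) < n * (n - 1) := by
    have : (0 : ℝ) < n := by linarith
    have : (0 : ℝ) < n - 1 := by linarith
    positivity
  refine div_le_div_of_nonneg_right ?_ hNpos.le
  have h4 : (0 : ℝ) ≤ 4 * (n - 2) := by linarith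
  have := mul_le_mul_of_nonneg_left hm1 h4
  nlinarith

/-- **Clean forms**: `E[(U − a)²] ≤ 4a(1 − a)/n + 2(1 − a²)/(n(n − 1)) ≤ (n + 1)/(n(n − 1))`
(`(n−2)/(n−1) ≤ 1`, `a(1−a) ≤ 1/4`, `1 − a² ≤ 1`); in particular `≤ 2/n` for `n ≥ 3`, against the
imported `4/n`. [folklore] -/
theorem variance_pairMin_le_sharp' {p q : X → ℝ} (hp : ∀ x, 0 ≤ p x) (hq : ∀ x, 0 < q x)
    (hp1 : ∑ x, p x = 1) (hq1 : ∑ x, q x = 1) (hn : 2 ≤ n) :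
    ∑ φ : Fin n → X, blockProd (fun _ => q) φ
        * ((∑ z ∈ (univ : Finset (Fin n)).offDiag, min (weight p q (φ z.1)) (weight p q (φ z.2)))
            / (n * (n - 1)) - accRate p q) ^ 2
      ≤ 4 * (accRate p q * (1 - accRate p q)) / n + 2 * (1 - accRate p q ^ 2) / (n * (n - 1)) ∧
    4 * (accRate p q * (1 - accRate p q)) / n + 2 * (1 - accRate p q ^ 2) / (n * (n - 1))
      ≤ (n + 1) / (n * (n - 1)) := by
  classical
  have h2 : (2 : ℝ) ≤ n := by exact_mod_cast hn
  have hnpos : (0 : ℝ) < n := by linarith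
  have hn1 : (0 : ℝ) < n - 1 := by linarith
  have hNpos : (0 : ℝ) < n * (n - 1) := mul_pos hnpos hn1
  have ha0 : 0 ≤ accRate p q := by
    unfold accRate
    exact sum_nonneg fun x _ => sum_nonneg fun y _ =>
      le_min (mul_nonneg (hp x) (hq y).le) (mul_nonneg (hp y) (hq x).le)
  have ha1 : accRate p q ≤ 1 :=
    (accRate_le hp1 hq1).trans (sub_le_self _ (tvDist_nonneg _ _))
  have hv := variance_pairMin_le_sharp hp hq hp1 hq1 hn
  set a := accRate p q with hadef
  have haa : 0 ≤ a * (1 - a) := mul_nonneg ha0 (by linarith)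
  constructor
  · refine hv.trans ?_
    have key : 4 * (n - 2) * (a * (1 - a)) / (n * (n - 1)) ≤ 4 * (a * (1 - a)) / n := by
      rw [div_le_div_iff₀ hNpos hnpos]
      nlinarith [mul_nonneg haa hnpos.le]
    rw [add_div]
    linarith
  · have h1 : 4 * (a * (1 - a)) / n ≤ 1 / n :=
      div_le_div_of_nonneg_right (by nlinarith [sq_nonneg (2 * a - 1)]) hnpos.le
    have h2' : 2 * (1 - a ^ 2) / (n * (n - 1)) ≤ 2 / (n * (n - 1)) :=
      div_le_div_of_nonneg_right (by nlinarith) hNpos.le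
    have h3 : 1 / (n : ℝ) + 2 / (n * (n - 1)) = (n + 1) / (n * (n - 1)) := by
      rw [div_add_div _ _ hnpos.ne' hNpos.ne',
        div_eq_div_iff (mul_ne_zero hnpos.ne' hNpos.ne') hNpos.ne']
      ring
    linarith

/-- **Chebyshev with the sharp envelope**: for every `t > 0`, the model probability that the
pair-min statistic on `n ≥ 2` fresh proposals misses the equilibrium acceptance `a` by `t` or more
is at most `(4a(1 − a)/n + 2(1 − a²)/(n(n − 1)))/t² ≤ (n + 1)/(n(n − 1)t²)`, for EVERY flow.
[folklore] -/
theorem chebyshev_pairMin_sharp {p q : X → ℝ} (hp : ∀ x, 0 ≤ p x) (hq : ∀ x, 0 < q x)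
    (hp1 : ∑ x, p x = 1) (hq1 : ∑ x, q x = 1) (hn : 2 ≤ n) {t : ℝ} (ht : 0 < t) :
    ∑ φ ∈ (univ : Finset (Fin n → X)).filter (fun φ => t ≤
        |(∑ z ∈ (univ : Finset (Fin n)).offDiag, min (weight p q (φ z.1)) (weight p q (φ z.2)))
            / (n * (n - 1)) - accRate p q|), blockProd (fun _ => q) φ
      ≤ (4 * (accRate p q * (1 - accRate p q)) / n + 2 * (1 - accRate p q ^ 2) / (n * (n - 1)))
          / t ^ 2 := by
  classical
  set U : (Fin n → X) → ℝ := fun φ =>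
    (∑ z ∈ (univ : Finset (Fin n)).offDiag, min (weight p q (φ z.1)) (weight p q (φ z.2)))
      / (n * (n - 1)) - accRate p q with hUdef
  set V : ℝ := 4 * (accRate p q * (1 - accRate p q)) / n
    + 2 * (1 - accRate p q ^ 2) / (n * (n - 1)) with hVdef
  have hbp : ∀ φ : Fin n → X, 0 ≤ blockProd (fun _ => q) φ :=
    fun φ => (blockProd_pos (fun _ z => hq z) φ).le
  have hvar : ∑ φ : Fin n → X, blockProd (fun _ => q) φ * U φ ^ 2 ≤ V :=
    (variance_pairMin_le_sharp' hp hq hp1 hq1 hn).1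
  have ht2 : 0 < t ^ 2 := pow_pos ht 2
  have hind : ∑ φ ∈ univ.filter (fun φ => t ≤ |U φ|), blockProd (fun _ => q) φ
      ≤ ∑ φ ∈ univ.filter (fun φ => t ≤ |U φ|), blockProd (fun _ => q) φ * (U φ ^ 2 / t ^ 2) := by
    refine sum_le_sum fun φ hφ => ?_
    have hle : t ≤ |U φ| := (mem_filter.mp hφ).2
    have : 1 ≤ U φ ^ 2 / t ^ 2 := by
      rw [le_div_iff₀ ht2, one_mul, ← sq_abs (U φ)]
      exact pow_le_pow_left₀ ht.le hle 2
    calc blockProd (fun _ => q) φ = blockProd (fun _ => q) φ * 1 := (mul_one _).symm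
      _ ≤ blockProd (fun _ => q) φ * (U φ ^ 2 / t ^ 2) := mul_le_mul_of_nonneg_left this (hbp φ)
  have hall : ∑ φ ∈ univ.filter (fun φ => t ≤ |U φ|), blockProd (fun _ => q) φ * (U φ ^ 2 / t ^ 2)
      ≤ ∑ φ : Fin n → X, blockProd (fun _ => q) φ * (U φ ^ 2 / t ^ 2) :=
    sum_le_sum_of_subset_of_nonneg (filter_subset _ _)
      (fun φ _ _ => mul_nonneg (hbp φ) (div_nonneg (sq_nonneg _) ht2.le))
  have hscale : ∑ φ : Fin n → X, blockProd (fun _ => q) φ * (U φ ^ 2 / t ^ 2)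
      = (∑ φ : Fin n → X, blockProd (fun _ => q) φ * U φ ^ 2) / t ^ 2 := by
    rw [sum_div]
    exact sum_congr rfl fun φ _ => by ring
  calc _ ≤ _ := hind
    _ ≤ _ := hall
    _ = _ := hscale
    _ ≤ V / t ^ 2 := div_le_div_of_nonneg_right hvar ht2.le

end PairMinSharp

/-! ### Sharpness: the hit-or-miss pair attains the envelope -/

section HitOrMiss

variable {n : ℕ}

/-- **The hit-or-miss pair.**  On two points, target `p = δ_hit = ![0, 1]` and model
`q = ![1 − α, α]` (`0 < α < 1`): the weights are `w(miss) = 0`, `w(hit) = 1/α`, the acceptance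
is `acc = α`, the conditional mean `h₁` is `0` at `miss` and `1` at `hit`, so `m₁ = α` and
`m₂ = 1` — both inequalities behind `variance_pairMin_le_sharp` are equalities. [folklore] -/
theorem hitOrMiss_moments {α : ℝ} (hα0 : 0 < α) (hα1 : α < 1) :
    accRate ![(0 : ℝ), 1] ![1 - α, α] = α ∧
    (∑ x, ![1 - α, α] x * (∑ y, ![1 - α, α] y
        * min (weight ![(0 : ℝ), 1] ![1 - α, α] x) (weight ![(0 : ℝ), 1] ![1 - α, α] y)) ^ 2) = α ∧
    (∑ x, ∑ y, ![1 - α, α] x * ![1 - α, α] y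
        * min (weight ![(0 : ℝ), 1] ![1 - α, α] x) (weight ![(0 : ℝ), 1] ![1 - α, α] y) ^ 2) = 1 := by
  have hα : α ≠ 0 := hα0.ne'
  have h1α : 0 ≤ 1 - α := by linarith
  have w0 : weight ![(0 : ℝ), 1] ![1 - α, α] 0 = 0 := by simp [weight]
  have w1 : weight ![(0 : ℝ), 1] ![1 - α, α] 1 = 1 / α := by simp [weight]
  have hiα : 0 ≤ 1 / α := by positivity
  refine ⟨?_, ?_, ?_⟩
  · unfold accRate
    simp only [Fin.sum_univ_two, Matrix.cons_val_zero, Matrix.cons_val_one, zero_mul, one_mul,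
      min_self, min_eq_left h1α, min_eq_right h1α]
    ring
  · simp only [Fin.sum_univ_two, Matrix.cons_val_zero, Matrix.cons_val_one, w0, w1, min_self,
      min_eq_left hiα, min_eq_right hiα]
    field_simp
    ring
  · simp only [Fin.sum_univ_two, Matrix.cons_val_zero, Matrix.cons_val_one, w0, w1, min_self,
      min_eq_left hiα, min_eq_right hiα]
    field_simp
    ring

/-- **The hit-or-miss pair attains the envelope exactly**, at every `n ≥ 2`:
`E[(U − α)²] = (2(1 − α²) + 4(n − 2)·α(1 − α)) / (n(n − 1))`. [folklore] -/
theorem hitOrMiss_variance_pairMin {α : ℝ} (hα0 : 0 < α) (hα1 : α < 1) (hn : 2 ≤ n) :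
    ∑ φ : Fin n → Fin 2, blockProd (fun _ => ![1 - α, α]) φ
        * ((∑ z ∈ (univ : Finset (Fin n)).offDiag,
            min (weight ![(0 : ℝ), 1] ![1 - α, α] (φ z.1)) (weight ![(0 : ℝ), 1] ![1 - α, α] (φ z.2)))
            / (n * (n - 1)) - accRate ![(0 : ℝ), 1] ![1 - α, α]) ^ 2
      = (2 * (1 - α ^ 2) + 4 * (n - 2) * (α * (1 - α))) / (n * (n - 1)) := by
  have hq : ∀ x, 0 < ![1 - α, α] x := by
    intro x; fin_cases x <;> simp <;> linarith
  have hq1 : ∑ x, ![1 - α, α] x = 1 := by simp [Fin.sum_univ_two]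
  obtain ⟨ha, hm1, hm2⟩ := hitOrMiss_moments hα0 hα1
  rw [variance_pairMin_eq hq hq1 hn, hm1, hm2, ha]
  ring

/-- **Sharpness of `variance_pairMin_le_sharp`.**  For every `n ≥ 2` and every acceptance
`a ∈ (0, 1)` there is a finite normalised pair (`p ≥ 0`, `q > 0`) with `acc(p, q) = a` whose
pair-min statistic has variance EXACTLY `(2(1 − a²) + 4(n − 2)a(1 − a))/(n(n − 1))`: the envelope is
the maximum of `Var U` at given acceptance, for every `n` — not only its leading constant is sharp.
[folklore] -/
theorem exists_variance_pairMin_eq_sharp (hn : 2 ≤ n) {a : ℝ} (ha0 : 0 < a) (ha1 : a < 1) :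
    ∃ p q : Fin 2 → ℝ, (∀ x, 0 ≤ p x) ∧ (∀ x, 0 < q x) ∧ ∑ x, p x = 1 ∧ ∑ x, q x = 1 ∧
      accRate p q = a ∧
      ∑ φ : Fin n → Fin 2, blockProd (fun _ => q) φ
          * ((∑ z ∈ (univ : Finset (Fin n)).offDiag, min (weight p q (φ z.1)) (weight p q (φ z.2)))
              / (n * (n - 1)) - accRate p q) ^ 2
        = (2 * (1 - a ^ 2) + 4 * (n - 2) * (a * (1 - a))) / (n * (n - 1)) := by
  refine ⟨![(0 : ℝ), 1], ![1 - a, a], ?_, ?_, by simp [Fin.sum_univ_two], by simp [Fin.sum_univ_two],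
    (hitOrMiss_moments ha0 ha1).1, hitOrMiss_variance_pairMin ha0 ha1 hn⟩
  · intro x; fin_cases x <;> simp
  · intro x; fin_cases x <;> simp <;> linarith

end HitOrMiss

end Summit.Ventures.LatticeQCDFlow.Scoring
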